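import Summits.ValiantsHypothesis.ValiantsHypothesis.Theorems.BarrierLeverDefinableDcEquationsLinearWindow
import HarnessLib

/-!
# Crux `BarrierLever.DefinableEquations` (stmt-8745) ⟺ `SingleSizeEquations` (stmt-8749) —
# the strength axis, RUNG ONE: algebraic natural proofs against bounded BALANCED STRENGTH
# `s = Θ(c·n / log n)` (the singular-locus certificate on a linear window)

Sibling of `BarrierLeverDefinableEquationsBalancedStrength.lean` (seat val-np-p5 gen 21): there,
`SmallCircuits ℂ n b ⊆ BP(n, 4n^b(n+1)²+1)` — every homogeneous component `hom_d f` is a sum of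
`≤ 4n^b(d+1)²+1` products `g·h` with `deg g, deg h ≤ ⌊(2d+2)/3⌋` — and explicit equations for the
bounded-balanced-strength class `BP` would settle the crux rung by rung.  Here: where the KNOWN
technique for equations of bounded strength (the singular locus: `str(f) ≤ r ⇒ codim Sing(f) ≤ 2r`,
Ananyan–Hochster / Gesmundo–Ghosal–Ikenmeyer–Lysikov) sits on this axis, in the kernel and in the
crux's currency (FSV distinguishers of `poly(N)` size, `N = C(2n,n)`).

* `eval_certPoly_eq_zero_of_balanced` — if `deg f ≤ n`, `n ≥ 3`, and the TOP component is a short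
  balanced sum `hom_n f = Σ_{i<s} g_i h_i`, `deg g_i, deg h_i ≤ ⌊(2n+2)/3⌋`, then for every window
  `w > 2s` the cell's Macaulay certificate `certPoly n w` (item 20156; the resultant-type
  determinant of the gradient of the top form restricted to the first `w` variables) vanishes at
  `coeff f`.  Mechanism = the cell's Kumar–Volk "case B engine"
  `DcConstantExcess.exists_ne_zero_grad_eq_zero_of_decomposition`: on the window, the `2s < w`
  constant-free parts of the restricted factors generate a homogeneous ideal of height `< w`
  containing the top form and its gradient, whence a nonzero common zero of `∇ hom_n(f|_w)`.
* `isNaturalProof_certPoly_balanced`, `not_isSuccinctHittingSet_balanced` — natural proofs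
  (`q = 0` Boolean variables, level `14w + 11`) against top balanced strength `s < w/2`, `w ≤ n`.
* §5 (appended) `exists_balanced_eval_certPoly_ne_zero` — TIGHTNESS: `certPoly n w` does not
  vanish on top balanced strength `w` (padded Fermat), so rung one ends between `w/2` and `w`.
* `naturalProofsAgainstBalancedStrengthWindow` — level form: for every `c` ONE level `14c + 11`
  serves, for all `n ≥ 2^c`, EVERY `s` with `(2s+1)(log₂ n + 1) ≤ c·n`, i.e. balanced strength
  `s = Θ(c·n / log n)`; `balancedEquations_window` — the same as nonzero level-`(14c+11)`
  Boolean-sum equations (with `q = 0`) for that class, the currency of the strength door.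

THE STRENGTH AXIS OF THE CRUX (chart sentence).  Explicit `poly(N)` equations for `BP(n, s)`:
`s ≤ Θ(c·n/log n)` — YES, `q = 0`, this file (the window is forced by the size `n^{O(w)}` of the
Macaulay certificate; with `w = n`, i.e. `s < n/2`, the same certificate has size `N^{Θ(log n)}` —
the singular-locus range `r ≤ n/2` of the literature, arXiv:2509.12322 Prop. 3 / §4);
`s = 4n^b(n+1)²+1 ≥ n³` — what the door to the crux at `b` needs (sibling file); in between —
OPEN, nothing in print.  Honest framing: a rung far below the door; nothing here bears on the
crux's verdict (OPEN at `b = 2`), on crux 14610, or on `VP ≠ VNP`, which is NOT proved.  No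
definitions, no named-fact hypotheses, standard axioms.

References: T. Ananyan, M. Hochster, J. AMS 33 (2020); F. Gesmundo, P. Ghosal, C. Ikenmeyer,
V. Lysikov, FSTTCS 2022 (arXiv:2205.02149); arXiv:2509.12322 (2025), Prop. 3; M. Kumar, B. L. Volk,
comput. complexity 31 (2022) §3 [KumarVolk2022b]; M. Forbes, A. Shpilka, B. L. Volk, Theory
Comput. 14 (2018), Def. 1 / Thm. 4 [ForbesShpilkaVolk2018]; D. Cox, J. Little, D. O'Shea, *Using
Algebraic Geometry*, Ch. 3 §4 [CoxLittleOSheaUsing2005].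
-/

-- layout Summits/ValiantsHypothesis/ValiantsHypothesis forces the duplicated namespace component
set_option linter.dupNamespace false

noncomputable section

open MvPolynomial Finset Matrix

namespace Summit.ValiantsHypothesis.ValiantsHypothesis.Theorems.BarrierLever.DcConstantExcess

open Literature.Computability.AlgebraicComplexity
open Literature.RingTheory.MvPolynomial.Macaulay
open Literature.Barriers.ValiantsHypothesis
open Summit.ValiantsHypothesis.ValiantsHypothesis.Theorems.BarrierLever.NaturalProofsAgainstAllLinearSizes
open Summit.ValiantsHypothesis.ValiantsHypothesis.Theorems.BarrierLever.DcEqualsDegree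

namespace BalancedWindow

/-! ## §1 The lower part of a polynomial of degree `≤ n` -/

/-- `deg (f - hom_n f) < n` for `deg f ≤ n`, `n ≥ 1`: the difference is the sum of the components
of degree `< n`. [folklore] -/
theorem totalDegree_sub_homogeneousComponent_lt {n : ℕ} (hn : 1 ≤ n)
    {σ : Type*} (f : MvPolynomial σ ℂ) (hf : f.totalDegree ≤ n) :
    (f - homogeneousComponent n f).totalDegree < n := by
  classical
  rcases Nat.lt_or_ge f.totalDegree n with hlt | hge
  · rw [homogeneousComponent_eq_zero _ _ hlt, sub_zero]
    exact hlt
  · have heq : f.totalDegree = n := le_antisymm hf hge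
    have hmem : n ∈ Finset.range (f.totalDegree + 1) := by
      rw [Finset.mem_range]; omega
    have hlow : f - homogeneousComponent n f =
        ∑ d ∈ (Finset.range (f.totalDegree + 1)).erase n, homogeneousComponent d f := by
      rw [Finset.sum_erase_eq_sub hmem, sum_homogeneousComponent]
    rw [hlow]
    refine lt_of_le_of_lt (totalDegree_finsetSum_le (d := n - 1) fun d hd => ?_) (by omega)
    rw [Finset.mem_erase, Finset.mem_range] at hd
    exact (homogeneousComponent_isHomogeneous d f).totalDegree_le.trans (by omega)

/-! ## §2 The certificate vanishes on short balanced sums -/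

/-- **The Macaulay certificate on a window `w > 2s` vanishes on every polynomial whose top
component has balanced strength `≤ s`.**  For `n ≥ 3`, `deg f ≤ n`,
`hom_n f = Σ_{i<s} g_i h_i` with `deg g_i, deg h_i ≤ ⌊(2n+2)/3⌋`, and `2s < w`:
`certPoly n w` vanishes at `coeff f`.  (Restrict to the first `w` variables; split each restricted
factor into constant and constant-free part; the cell's Kumar–Volk case-B engine gives a nonzero
common zero of the gradient of the top form; the Macaulay determinant dies.)
[cite: KumarVolk2022b, §3; CoxLittleOSheaUsing2005, Ch. 3 §4] -/
theorem eval_certPoly_eq_zero_of_balanced {n s w : ℕ} (hn : 3 ≤ n) (hsw : 2 * s < w)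
    (f : MvPolynomial (Fin n) ℂ) (hdeg : f.totalDegree ≤ n)
    (g h : Fin s → MvPolynomial (Fin n) ℂ)
    (hg : ∀ i, (g i).totalDegree ≤ (2 * n + 2) / 3) (hh : ∀ i, (h i).totalDegree ≤ (2 * n + 2) / 3)
    (hsum : homogeneousComponent n f = ∑ i, g i * h i) :
    eval (coeffVector (degLEMonomials n) f) (certPoly n w) = 0 := by
  classical
  set A : ℕ := (2 * n + 2) / 3 with hA
  let ρ : MvPolynomial (Fin n) ℂ →ₐ[ℂ] MvPolynomial (Fin w) ℂ := aeval (restr ℂ n w)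
  -- constant / constant-free splitting of the restricted factors
  let P : Fin s → MvPolynomial (Fin w) ℂ := fun i => ρ (g i) - C (constantCoeff (ρ (g i)))
  let Q : Fin s → MvPolynomial (Fin w) ℂ := fun i => ρ (h i) - C (constantCoeff (ρ (h i)))
  let N₀₀ : MvPolynomial (Fin w) ℂ :=
    ∑ i, (C (constantCoeff (ρ (g i))) * Q i + C (constantCoeff (ρ (h i))) * P i +
      C (constantCoeff (ρ (g i))) * C (constantCoeff (ρ (h i)))) + ρ (f - homogeneousComponent n f)
  have hP0 : ∀ i, constantCoeff (P i) = 0 := fun i => by simp [P]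
  have hQ0 : ∀ i, constantCoeff (Q i) = 0 := fun i => by simp [Q]
  have hdegsubC : ∀ (p : MvPolynomial (Fin w) ℂ) (c : ℂ), (p - C c).totalDegree ≤ p.totalDegree :=
    fun p c => (totalDegree_sub_C_le p c)
  have hPdeg : ∀ i, (P i).totalDegree ≤ A := fun i =>
    (hdegsubC _ _).trans ((totalDegree_aeval_restr_le (g i)).trans (hg i))
  have hQdeg : ∀ i, (Q i).totalDegree ≤ A := fun i =>
    (hdegsubC _ _).trans ((totalDegree_aeval_restr_le (h i)).trans (hh i))
  have hAn : A < n := by omega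
  have hN : N₀₀.totalDegree < n := by
    refine lt_of_le_of_lt (totalDegree_add _ _) (max_lt ?_ ?_)
    · refine lt_of_le_of_lt (totalDegree_finsetSum_le (d := n - 1) fun i _ => ?_) (by omega)
      refine Nat.le_sub_one_of_lt ?_
      refine lt_of_le_of_lt (totalDegree_add _ _) (max_lt ?_ ?_)
      · refine lt_of_le_of_lt (totalDegree_add _ _) (max_lt ?_ ?_)
        · exact lt_of_le_of_lt ((totalDegree_mul _ _).trans (by rw [totalDegree_C, zero_add]))
            ((hQdeg i).trans_lt hAn)
        · exact lt_of_le_of_lt ((totalDegree_mul _ _).trans (by rw [totalDegree_C, zero_add]))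
            ((hPdeg i).trans_lt hAn)
      · rw [← map_mul, totalDegree_C]; omega
    · exact lt_of_le_of_lt (totalDegree_aeval_restr_le _)
        (totalDegree_sub_homogeneousComponent_lt (by omega) f hdeg)
  have hFdeg : (ρ f).totalDegree ≤ n := (totalDegree_aeval_restr_le f).trans hdeg
  have hid : ρ f = ∑ i, P i * Q i + N₀₀ := by
    have hf : f = homogeneousComponent n f + (f - homogeneousComponent n f) := by ring
    calc ρ f = ρ (homogeneousComponent n f) + ρ (f - homogeneousComponent n f) := by
          conv_lhs => rw [hf]
          rw [map_add]
      _ = ∑ i, ρ (g i) * ρ (h i) + ρ (f - homogeneousComponent n f) := by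
          rw [hsum, map_sum]
          simp_rw [map_mul]
      _ = ∑ i, (P i * Q i + (C (constantCoeff (ρ (g i))) * Q i + C (constantCoeff (ρ (h i))) * P i +
            C (constantCoeff (ρ (g i))) * C (constantCoeff (ρ (h i))))) +
            ρ (f - homogeneousComponent n f) := by
          congr 1
          refine Finset.sum_congr rfl fun i _ => ?_
          simp only [P, Q]
          ring
      _ = ∑ i, P i * Q i + N₀₀ := by
          rw [Finset.sum_add_distrib]
          simp only [N₀₀]
          ring
  obtain ⟨ζ, hζ, hgrad⟩ := exists_ne_zero_grad_eq_zero_of_decomposition (ι := Fin s) (n := n)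
    (E := A) (by simpa using hsw) (ρ f) N₀₀ P Q hP0 hQ0 hPdeg hQdeg hN hFdeg (by omega) hid
  rw [eval_certPoly w f hdeg]
  exact det_macaulay_grad_eq_zero _ (homogeneousComponent_isHomogeneous n _) ζ hζ hgrad

/-! ## §3 Natural proofs against bounded balanced strength on a linear window -/

/-- **An algebraic natural proof against top balanced strength `s < w/2`** (FSV Def. 1): for
`3 ≤ n`, `2s < w ≤ n`, the cell's `certPoly n w` is a nonzero level-`(14w + 11)` distinguisher
vanishing on every `f` with `deg f ≤ n` whose top component is `Σ_{i<s} g_i h_i`,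
`deg g_i, deg h_i ≤ ⌊(2n+2)/3⌋`. [cite: ForbesShpilkaVolk2018, Def. 1; KumarVolk2022b, §3] -/
theorem isNaturalProof_certPoly_balanced {n s w : ℕ} (hn : 3 ≤ n) (hsw : 2 * s < w) (hwn : w ≤ n) :
    IsNaturalProof (degLEMonomials n)
      {f : MvPolynomial (Fin n) ℂ | f.totalDegree ≤ n ∧
        ∃ g h : Fin s → MvPolynomial (Fin n) ℂ,
          (∀ i, (g i).totalDegree ≤ (2 * n + 2) / 3 ∧ (h i).totalDegree ≤ (2 * n + 2) / 3) ∧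
          homogeneousComponent n f = ∑ i, g i * h i}
      (Distinguishers ℂ n (14 * w + 11)) (certPoly n w) := by
  refine ⟨certPoly_mem_distinguishers_window (by omega) hwn (by omega),
    certPoly_ne_zero (by omega) hwn, fun f hf => ?_⟩
  obtain ⟨hdeg, g, h, hgh, hsum⟩ := hf
  exact eval_certPoly_eq_zero_of_balanced hn hsw f hdeg g h (fun i => (hgh i).1)
    (fun i => (hgh i).2) hsum

/-- **Hitting-set reading**: for `3 ≤ n`, `2s < w ≤ n`, the polynomials of degree `≤ n` with top
balanced strength `≤ s` are NOT a succinct hitting set for `Distinguishers ℂ n (14w + 11)`.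
[cite: ForbesShpilkaVolk2018, Thm. 4] -/
theorem not_isSuccinctHittingSet_balanced {n s w : ℕ} (hn : 3 ≤ n) (hsw : 2 * s < w) (hwn : w ≤ n) :
    ¬ IsSuccinctHittingSet (degLEMonomials n)
      {f : MvPolynomial (Fin n) ℂ | f.totalDegree ≤ n ∧
        ∃ g h : Fin s → MvPolynomial (Fin n) ℂ,
          (∀ i, (g i).totalDegree ≤ (2 * n + 2) / 3 ∧ (h i).totalDegree ≤ (2 * n + 2) / 3) ∧
          homogeneousComponent n f = ∑ i, g i * h i}
      (Distinguishers ℂ n (14 * w + 11)) := by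
  rw [← exists_isNaturalProof_iff]
  exact ⟨certPoly n w, isNaturalProof_certPoly_balanced hn hsw hwn⟩

/-! ## §4 Level form: ONE level `14c + 11` against balanced strength `Θ(c·n / log n)` -/

/-- **Natural proofs against balanced strength `s = Θ(c·n / log n)`, level form.**  For every `c`
there is ONE level `a = 14c + 11` such that for all `n ≥ max(2^c, 3)` and EVERY `s` with
`(2s + 1)(log₂ n + 1) ≤ c·n`, the class "`deg f ≤ n`, top component of balanced strength `≤ s`"
is not a succinct hitting set for `Distinguishers ℂ n a` (witness `certPoly n (2s+1)`, size
`n^{O(s)} ≤ N^{O(c)}`). [cite: ForbesShpilkaVolk2018, Thm. 4; KumarVolk2022b, §3] -/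
theorem naturalProofsAgainstBalancedStrengthWindow (c : ℕ) :
    ∃ a n₀ : ℕ, ∀ n ≥ n₀, ∀ s : ℕ, (2 * s + 1) * (Nat.log 2 n + 1) ≤ c * n →
      ¬ IsSuccinctHittingSet (degLEMonomials n)
        {f : MvPolynomial (Fin n) ℂ | f.totalDegree ≤ n ∧
          ∃ g h : Fin s → MvPolynomial (Fin n) ℂ,
            (∀ i, (g i).totalDegree ≤ (2 * n + 2) / 3 ∧ (h i).totalDegree ≤ (2 * n + 2) / 3) ∧
            homogeneousComponent n f = ∑ i, g i * h i}
        (Distinguishers ℂ n a) := by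
  refine ⟨14 * c + 11, max (2 ^ c) 3, fun n hn s hs => ?_⟩
  have hn2 : 2 ^ c ≤ n := le_of_max_le_left hn
  have hn3 : 3 ≤ n := le_of_max_le_right hn
  have hwn : 2 * s + 1 ≤ n := window_le hn2 (by omega) hs
  rw [← exists_isNaturalProof_iff]
  refine ⟨certPoly n (2 * s + 1),
    certPoly_mem_distinguishers_of_window (by omega) (by omega) hwn hs,
    certPoly_ne_zero (by omega) hwn, fun f hf => ?_⟩
  obtain ⟨hdeg, g, h, hgh, hsum⟩ := hf
  exact eval_certPoly_eq_zero_of_balanced hn3 (by omega) f hdeg g h (fun i => (hgh i).1)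
    (fun i => (hgh i).2) hsum

/-- **The same in the currency of the strength door** (Boolean-sum equations, here with `q = 0`):
for every `c`, eventually in `n`, for every `s` with `(2s+1)(log₂ n + 1) ≤ c·n` there is a nonzero
level-`(14c+11)` Boolean-sum equation vanishing at `coeff f` for every `f` of degree `≤ n` whose
top component has balanced strength `≤ s` — the rung `s = Θ(c·n/log n)` of the axis whose rung
`s = 4n^b(n+1)²+1` is the crux at `b` (sibling file, `singleSize_at_of_balanced_equations`).
[cite: ForbesShpilkaVolk2018, Def. 1; KumarVolk2022b, §3] -/
theorem balancedEquations_window (c : ℕ) :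
    ∃ a n₀ : ℕ, ∀ n ≥ n₀, ∀ s : ℕ, (2 * s + 1) * (Nat.log 2 n + 1) ≤ c * n →
      ∃ q : ℕ, q ≤ (Nat.choose (2 * n) n) ^ a ∧
        ∃ H : MvPolynomial (↥(degLEMonomials n) ⊕ Fin q) ℂ,
          complexity H ≤ (Nat.choose (2 * n) n) ^ a ∧ H.totalDegree ≤ (Nat.choose (2 * n) n) ^ a ∧
          boolSum H ≠ 0 ∧
          ∀ f ∈ {f : MvPolynomial (Fin n) ℂ | f.totalDegree ≤ n ∧
              ∃ g h : Fin s → MvPolynomial (Fin n) ℂ,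
                (∀ i, (g i).totalDegree ≤ (2 * n + 2) / 3 ∧ (h i).totalDegree ≤ (2 * n + 2) / 3) ∧
                homogeneousComponent n f = ∑ i, g i * h i},
            eval (coeffVector (degLEMonomials n) f) (boolSum H) = 0 := by
  obtain ⟨a, n₀, hnat⟩ := naturalProofsAgainstBalancedStrengthWindow c
  refine ⟨a, n₀, fun n hn s hs => ?_⟩
  have h := hnat n hn s hs
  rw [← exists_isNaturalProof_iff] at h
  obtain ⟨D, hDmem, hD0, hDvan⟩ := h
  refine ⟨0, Nat.zero_le _, rename Sum.inl D, ?_, ?_, ?_, ?_⟩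
  · exact (complexity_rename_le_holds' _ _).trans hDmem.1
  · exact (totalDegree_rename_le _ _).trans hDmem.2
  · rw [boolSum_rename_inl_zero]; exact hD0
  · intro f hf
    rw [boolSum_rename_inl_zero]
    exact hDvan f hf


/-! ## §5 (appended) Tightness of rung one: the window certificate does not reach strength `w` -/

/-- **The certificate `certPoly n w` does NOT vanish on top balanced strength `w`** (so its reach
on the strength axis, `s < w/2` by `eval_certPoly_eq_zero_of_balanced`, is tight up to the factor
`2`): the padded Fermat polynomial `Σ_{j<w} x_j^n / n` has top component of balanced strength `≤ w`
(`w` products `x_j^{⌊n/2⌋} · x_j^{n−⌊n/2⌋}`), and the certificate takes the value `det = 1` there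
(the computation of the cell's `certPoly_ne_zero`).  (Exact tightness, strength `⌈w/2⌉`, holds
too — `x^n + y^n` splits into linear forms over `ℂ` — but is not typed here.)
[cite: CoxLittleOSheaUsing2005, Ch. 3 §4; ForbesShpilkaVolk2018, Def. 1] -/
theorem exists_balanced_eval_certPoly_ne_zero {n w : ℕ} (hn : 1 ≤ n) (hwn : w ≤ n) :
    ∃ f ∈ {f : MvPolynomial (Fin n) ℂ | f.totalDegree ≤ n ∧
        ∃ g h : Fin w → MvPolynomial (Fin n) ℂ,
          (∀ i, (g i).totalDegree ≤ (2 * n + 2) / 3 ∧ (h i).totalDegree ≤ (2 * n + 2) / 3) ∧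
          homogeneousComponent n f = ∑ i, g i * h i},
      eval (coeffVector (degLEMonomials n) f) (certPoly n w) ≠ 0 := by
  classical
  set f₀ : MvPolynomial (Fin n) ℂ := ∑ i : Fin w, C ((n : ℂ)⁻¹) * X (Fin.castLE hwn i) ^ n
    with hf₀def
  have hdeg : f₀.totalDegree ≤ n := by
    refine totalDegree_finsetSum_le fun i _ => (totalDegree_mul _ _).trans ?_
    rw [totalDegree_C, totalDegree_X_pow, zero_add]
  have hhom₀ : f₀.IsHomogeneous n := by
    refine IsHomogeneous.sum _ _ _ fun i _ => ?_
    simpa using (isHomogeneous_C (Fin n) ((n : ℂ)⁻¹)).mul (isHomogeneous_X_pow (Fin.castLE hwn i) n)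
  refine ⟨f₀, ⟨hdeg, fun i => C ((n : ℂ)⁻¹) * X (Fin.castLE hwn i) ^ (n / 2),
    fun i => X (Fin.castLE hwn i) ^ (n - n / 2), fun i => ⟨?_, ?_⟩, ?_⟩, ?_⟩
  · refine (totalDegree_mul _ _).trans ?_
    rw [totalDegree_C, totalDegree_X_pow, zero_add]; omega
  · rw [totalDegree_X_pow]; omega
  · rw [homogeneousComponent_eq_self hhom₀, hf₀def]
    refine Finset.sum_congr rfl fun i _ => ?_
    rw [mul_assoc, ← pow_add, Nat.add_sub_cancel' (Nat.div_le_self n 2)]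
  -- the value of the certificate at `f₀` is `det = 1`
  set F₀ : MvPolynomial (Fin w) ℂ := ∑ i : Fin w, C ((n : ℂ)⁻¹) * X i ^ n with hF₀def
  have hres : aeval (restr ℂ n w) f₀ = F₀ := by
    simp only [hf₀def, hF₀def, map_sum, map_mul, map_pow, aeval_X, restr_castLE, aeval_C,
      algebraMap_eq]
  have hhom : F₀.IsHomogeneous n := by
    refine IsHomogeneous.sum _ _ _ fun i _ => ?_
    simpa using (isHomogeneous_C (Fin w) ((n : ℂ)⁻¹)).mul (isHomogeneous_X_pow (i : Fin w) n)
  have hn0 : (n : ℂ) ≠ 0 := Nat.cast_ne_zero.2 (by omega)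
  have hpd : ∀ i : Fin w, pderiv i F₀ = X i ^ (n - 1) := by
    intro i
    rw [hF₀def, map_sum, Finset.sum_eq_single i]
    · rw [pderiv_C_mul, pderiv_pow, pderiv_X_self, mul_one, ← mul_assoc, ← map_natCast C n,
        ← map_mul, inv_mul_cancel₀ hn0, map_one, one_mul]
    · intro j _ hj
      rw [pderiv_C_mul, pderiv_pow, pderiv_X_of_ne hj, mul_zero, mul_zero]
    · simp
  intro h0
  have h1 := eval_certPoly w f₀ hdeg
  rw [h0, hres, homogeneousComponent_eq_self hhom] at h1
  simp_rw [hpd] at h1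
  rw [det_macaulay_X_pow] at h1
  exact zero_ne_one h1

/-- **Hence balanced strength `w` is NOT killed by the window-`w` certificate**: for
`1 ≤ w ≤ n` the class "top balanced strength `≤ w`" is not annihilated by `certPoly n w` — the
rung-one method (singular locus on a `w`-window) ends between `s < w/2` and `s = w`.
[cite: ForbesShpilkaVolk2018, Def. 1] -/
theorem not_forall_balanced_eval_certPoly_eq_zero {n w : ℕ} (hn : 1 ≤ n) (hwn : w ≤ n) :
    ¬ ∀ f ∈ {f : MvPolynomial (Fin n) ℂ | f.totalDegree ≤ n ∧
        ∃ g h : Fin w → MvPolynomial (Fin n) ℂ,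
          (∀ i, (g i).totalDegree ≤ (2 * n + 2) / 3 ∧ (h i).totalDegree ≤ (2 * n + 2) / 3) ∧
          homogeneousComponent n f = ∑ i, g i * h i},
      eval (coeffVector (degLEMonomials n) f) (certPoly n w) = 0 := by
  intro h
  obtain ⟨f, hf, hne⟩ := exists_balanced_eval_certPoly_ne_zero hn hwn
  exact hne (h f hf)

end BalancedWindow

end Summit.ValiantsHypothesis.ValiantsHypothesis.Theorems.BarrierLever.DcConstantExcess
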